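import Mathlib
import Summits.AtomisticToContinuum.Crystallization.Theorems.ReggeStarCoercivityDefectFreeCrystallizesDefs
import Literature.MathematicalPhysics.StatisticalMechanics.LocalMatchingCompactness
import Literature.Geometry.DiscreteGeometry.LayerStackings

/-!
# Part 0 (definitions): helper predicates and data of the proof of `LayeredGluing`

Imports the line vocabulary (`layeredPos`, `InBox`, `LayeredNear`, `LayeredGluing`, …) from
`ReggeStarCoercivityDefectFreeCrystallizesDefs`; declares the predicates `SetLayeredNear`, `ExactNear`,
`ExactLayeredRigidity`, `GluingWindow`, `FramedAt`, `AllFramed`, `LayerFramed`, `HalfFramedAt`, `TemplateAt`, `CubicAt`,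
`FullyCubic`, `CaseI` and the data `hexLabels`, `upLabels`, `downLabels`, `idealZ`, `nbrLabels`, `reflectZ` used by the proof files
`…LayeredGluing01 … 14` and `…LayeredGluing`. Nothing is asserted here.
-/

noncomputable section

open scoped BigOperators Classical InnerProductSpace
open Filter Topology

namespace Summit.AtomisticToContinuum.Crystallization.Theorems.PrestressSplitKorn

open Summit.AtomisticToContinuum.Crystallization.Theses
open Summit.AtomisticToContinuum.Crystallization.Theses.ReggeStarCoercivity
open Summit.AtomisticToContinuum.Crystallization.Theorems.DefectFreeCrystallizes.Negative.PredicateAPI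
open Literature.MathematicalPhysics.StatisticalMechanics Literature.Geometry.DiscreteGeometry

local notation "E3" => EuclideanSpace ℝ (Fin 3)

/-! ## Helper predicates of the proof of `LayeredGluing` (Prop-valued) -/

/-- Set version of `LayeredNear` (the 2-ball of the point `q` of `Z` is two-way `η`-matched, after the
translation `t`, to a rigid image of a box template). -/
def SetLayeredNear (η : ℝ) (Z : Set E3) (q : E3) : Prop :=
  ∃ (A : E3 →ₗᵢ[ℝ] E3) (t : E3) (a : ℝ) (s : ℤ → ℤ) (z : ℤ → ℝ), InBox a z ∧ IsHaggSeq s ∧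
    (∀ y ∈ Z, dist y q ≤ 2 → ∃ l, dist (y + t) (A (layeredPos a s z l)) ≤ η) ∧
    (∀ l, dist (A (layeredPos a s z l)) (q + t) ≤ 2 →
      ∃ y ∈ Z, dist (y + t) (A (layeredPos a s z l)) ≤ η)

/-- `Y` is EXACTLY a rigid image of a box template on the open 2-ball about `p` (after the
translation `t`). -/
def ExactNear (Y : Set E3) (p : E3) : Prop :=
  ∃ (A : E3 →ₗᵢ[ℝ] E3) (t : E3) (a : ℝ) (s : ℤ → ℤ) (z : ℤ → ℝ), InBox a z ∧ IsHaggSeq s ∧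
    (∀ y ∈ Y, dist y p < 2 → ∃ l, y + t = A (layeredPos a s z l)) ∧
    (∀ l, dist (A (layeredPos a s z l)) (p + t) < 2 → A (layeredPos a s z l) - t ∈ Y)

/-- **Exact local-to-global rigidity of box templates** (the `η = 0` core of the gluing lemma): a
nonempty uniformly discrete `Y ⊆ ℝ³` every point of which is exactly layered on its open 2-ball is
globally ONE rigid image of ONE box template. -/
def ExactLayeredRigidity : Prop :=
  ∀ Y : Set E3, Y.Nonempty → UniformlyDiscrete Y → (∀ p ∈ Y, ExactNear Y p) →
    ∃ (A : E3 →ₗᵢ[ℝ] E3) (t : E3) (a : ℝ) (s : ℤ → ℤ) (z : ℤ → ℝ), InBox a z ∧ IsHaggSeq s ∧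
      Y = {y | ∃ l, y + t = A (layeredPos a s z l)}

/-- The window predicate of `LayeredGluing`'s conclusion, with the range unfolded. -/
def GluingWindow {N : ℕ} (R ε : ℝ) (x : Fin N → E3) (A : E3 →ₗᵢ[ℝ] E3) (t : E3) (a : ℝ) (s : ℤ → ℤ)
    (z : ℤ → ℝ) : Prop :=
  (∀ l, ‖A (layeredPos a s z l)‖ ≤ R → ∃ j : Fin N, dist (x j + t) (A (layeredPos a s z l)) ≤ ε) ∧
    (∀ j : Fin N, ‖x j + t‖ ≤ R → ∃ l, dist (x j + t) (A (layeredPos a s z l)) ≤ ε)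

/-- `Y` is exactly the identity-framed box template `(a, s, z)` (based at `p`, `z 0 = 0`) on the open
2-ball about its point `p`. -/
def FramedAt (a : ℝ) (Y : Set E3) (p : E3) (s : ℤ → ℤ) (z : ℤ → ℝ) : Prop :=
  InBox a z ∧ IsHaggSeq s ∧ z 0 = 0 ∧
    (∀ y ∈ Y, dist y p < 2 → ∃ l, y = p + layeredPos a s z l) ∧
    (∀ l, ‖layeredPos a s z l‖ < 2 → p + layeredPos a s z l ∈ Y)

/-- Hypothesis of Part II: every point carries an identity-framed exact template of spacing `a`. -/
def AllFramed (a : ℝ) (Y : Set E3) : Prop := ∀ p ∈ Y, ∃ (s : ℤ → ℤ) (z : ℤ → ℝ), FramedAt a Y p s z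

/-- All lattice points of the layer of `p` carry identity-framed exact templates. -/
def LayerFramed (a : ℝ) (Y : Set E3) (p : E3) : Prop :=
  ∀ i j : ℤ, ∃ (s : ℤ → ℤ) (z : ℤ → ℝ), FramedAt a Y (p + ((i : ℝ) • triangularVec₁ a + (j : ℝ) • triangularVec₂ a)) s z

/-- Known identity-framed structure around `q` at heights `≤ z 1` (what the layer below provides). -/
def HalfFramedAt (a : ℝ) (Y : Set E3) (q : E3) (s : ℤ → ℤ) (z : ℤ → ℝ) : Prop :=
  InBox a z ∧ IsHaggSeq s ∧ z 0 = 0 ∧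
    (∀ y ∈ Y, dist y q < 2 → y 2 - q 2 ≤ z 1 → ∃ l, y = q + layeredPos a s z l) ∧
    (∀ l : ℤ × ℤ × ℤ, ‖layeredPos a s z l‖ < 2 → l.1 ≤ 1 → q + layeredPos a s z l ∈ Y)

/-- An exact template at `q` in an arbitrary frame `E`, based at `q` (label `0 ↦ q`). -/
def TemplateAt (Y : Set E3) (q : E3) (E : E3 ≃ₗᵢ[ℝ] E3) (a' : ℝ) (s' : ℤ → ℤ) (z' : ℤ → ℝ) : Prop :=
  InBox a' z' ∧ IsHaggSeq s' ∧ z' 0 = 0 ∧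
    (∀ y ∈ Y, dist y q < 2 → ∃ l, y = q + E (layeredPos a' s' z' l)) ∧
    (∀ l, ‖layeredPos a' s' z' l‖ < 2 → q + E (layeredPos a' s' z' l) ∈ Y)

/-- "Cubic-ideal at the base layer": letters `s (-1) = s 0` and ideal heights `z (±1) = ± √(2/3) a`. -/
def CubicAt (a : ℝ) (s : ℤ → ℤ) (z : ℤ → ℝ) : Prop :=
  s (-1) = s 0 ∧ z 1 = Real.sqrt (2 / 3) * a ∧ z (-1) = -(Real.sqrt (2 / 3) * a)

/-- "Fully ideal": in addition `s 1 = s 0 = s (-2)` and `z (±2) = ± 2 √(2/3) a`. -/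
def FullyCubic (a : ℝ) (s : ℤ → ℤ) (z : ℤ → ℝ) : Prop :=
  CubicAt a s z ∧ s 1 = s 0 ∧ s (-2) = s 0 ∧ z 2 = 2 * (Real.sqrt (2 / 3) * a) ∧
    z (-2) = -(2 * (Real.sqrt (2 / 3) * a))

/-- **Case I**: every based template at every point of `Y` is cubic-ideal at its base layer. -/
def CaseI (Y : Set E3) : Prop :=
  ∀ q ∈ Y, ∀ (E : E3 ≃ₗᵢ[ℝ] E3) (a : ℝ) (s : ℤ → ℤ) (z : ℤ → ℝ), TemplateAt Y q E a s z → CubicAt a s z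

/-! ## Data definitions of the proof (label sets, ideal heights, the vertical reflection) -/

/-- Labels of the in-layer hexagon. -/
def hexLabels : Finset (ℤ × ℤ × ℤ) := {(0, 1, 0), (0, -1, 0), (0, 0, 1), (0, 0, -1), (0, 1, -1), (0, -1, 1)}

/-- Labels of the nearest triangle of layer `1` (word letter `σ = s 0`). -/
def upLabels (σ : ℤ) : Finset (ℤ × ℤ × ℤ) := {(1, 0, 0), (1, -σ, 0), (1, 0, -σ)}

/-- Labels of the nearest triangle of layer `-1` (word letter `σ' = s (-1)`). -/
def downLabels (σ' : ℤ) : Finset (ℤ × ℤ × ℤ) := {(-1, 0, 0), (-1, σ', 0), (-1, 0, σ')}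

/-- Ideal heights `m ↦ m √(2/3) a`. -/
def idealZ (a : ℝ) (m : ℤ) : ℝ := (m : ℝ) * (Real.sqrt (2 / 3) * a)

/-- All twelve neighbour labels of the origin site. -/
def nbrLabels (s : ℤ → ℤ) : Finset (ℤ × ℤ × ℤ) := hexLabels ∪ upLabels (s 0) ∪ downLabels (s (-1))

/-- The reflection in the horizontal plane. -/
def reflectZ : E3 ≃ₗᵢ[ℝ] E3 := Submodule.reflection (ℝ ∙ (layerNormal 1 : E3))ᗮ

/-- Landing anchor of this file (registered stub of crux stmt-AtomisticToContinuum-13603; re-exports a result above). -/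
theorem layeredGluing_defs_anchor :
    ∀ (a : ℝ) (Y : Set (EuclideanSpace ℝ (Fin 3))), AllFramed a Y ↔ ∀ p ∈ Y, ∃ (s : ℤ → ℤ) (z : ℤ → ℝ), FramedAt a Y p s z :=
  fun _ _ => Iff.rfl

end Summit.AtomisticToContinuum.Crystallization.Theorems.PrestressSplitKorn
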